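import Summits.FinalStateConjecture.FinalStateConjecture.Theses.KerrnessPropagates

/-!
# Route KerrnessPropagates · item `Assembly` (stmt-FinalStateConjecture-9929)

Pure logic. The route decl
`Summit.FinalStateConjecture.FinalStateConjecture.Theses.KerrnessPropagates.Assembly` reads
`MaximalDevelopmentExists → KerrBasinCapture → KillingSpinorEndgame → FinalStateConjecture`,
which is verbatim the type of the route's (sorry-free) deciding theorem
`Theses.KerrnessPropagates.closes`: fix the regularity `k` given by `KillingSpinorEndgame`; for
every admissible datum `D'`, `MaximalDevelopmentExists` and `KillingSpinorEndgame` turn the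
capture property `Q_k D'` ("every MGHD has complete 𝓘⁺ and recurs to one fixed sub-extremal
multi-Kerr configuration") into the Statement's property `P D'` (an MGHD exists, and every MGHD
has complete 𝓘⁺ and an exhaustive C² final-state decomposition with sub-extremal holes of its
self-determined exterior); Christodoulou genericity `IsChristodoulouGeneric 𝓓 · 1` is monotone in
the property (antitone in the exceptional set), so `KerrBasinCapture k X` — genericity of `Q_k` —
transfers to genericity of `P`, which is `FinalStateConjecture`. No hypothesis beyond the three
displayed ones enters; the proof is `closes` itself.
-/

-- `Summit.FinalStateConjecture.FinalStateConjecture.…` is the tree's mandated namespace (summit = sub-problem).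
set_option linter.dupNamespace false

namespace Summit.FinalStateConjecture.FinalStateConjecture.Theorems

/-- **Item `Assembly` (stmt-FinalStateConjecture-9929), route KerrnessPropagates.**
`MaximalDevelopmentExists → KerrBasinCapture → KillingSpinorEndgame → FinalStateConjecture`:
after unfolding, this is exactly the route's deciding theorem
`Theses.KerrnessPropagates.closes` (monotone-genericity transfer of the pointwise implication
capture-property ⇒ Statement-property on admissible data, with `k` fixed by the endgame).
Pure logic; closes the assembly item. -/
theorem KerrnessPropagates.assembly_proof :
    Summit.FinalStateConjecture.FinalStateConjecture.Theses.KerrnessPropagates.Assembly := by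
  unfold Summit.FinalStateConjecture.FinalStateConjecture.Theses.KerrnessPropagates.Assembly
  exact Summit.FinalStateConjecture.FinalStateConjecture.Theses.KerrnessPropagates.closes

end Summit.FinalStateConjecture.FinalStateConjecture.Theorems
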